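import Summits.Ventures.HodgeRepro2.T5WeightProjector
import Summits.Ventures.HodgeRepro2.T5CircleWeightSpaces
import Summits.Ventures.HodgeRepro2.T5WeightDecomposition

/-!
# The weight projectors kill the other weight spaces and sum to the identity

Tier-5 support (N4.3 = (R3), step (P2′): the `K`-type decomposition `v = Σₙ vₙ` of a vector in a
representation of `SO(2)`; route/T5-SUPPORT-p1.md §S4.12–§S4.13).  Continuation of
`T5KTypeProjector` / `T5WeightProjector`:

* `charProj_apply_eq_zero_of_mem_isotypic`: the `K`-type projector of `σ` vanishes on the
  `τ`-isotypic component for `τ ≄ σ`;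
* `weightProj_apply_eq_zero_of_mem_weightSpace`: the weight projector of `χ` vanishes on the
  weight space of `χ' ≠ χ` (`T5WeightDecomposition.isEmpty_equiv_charRep_of_ne`);
* `weightProj_zpowChar_apply`: on the circle group, the projector of the character `z ↦ zⁿ` is
  `v ↦ ∫ conj (zⁿ) • π z v`;
* `sum_weightProj_zpowChar_eq_self`: **the Fourier expansion** `v = Σ_{n ∈ weights π} Pₙ v` of
  every vector of a continuous finite-dimensional representation of `SO(2)` into its `K`-types.

What this file does NOT say: anything about the infinite-dimensional `π₃⁺` ([C] in N4.3).

Blind lane: Mathlib + own prefix; no sorry; axioms ⊆ {propext, Classical.choice, Quot.sound}.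
-/

namespace Summit.Ventures.HodgeRepro2.T5WeightProjectorSum

open MeasureTheory
open Summit.Ventures.HodgeRepro2.T5SchurOrthogonality Summit.Ventures.HodgeRepro2.T5SchurMathlib
  Summit.Ventures.HodgeRepro2.T5WeightSpaces Summit.Ventures.HodgeRepro2.T5KTypeProjector
  Summit.Ventures.HodgeRepro2.T5WeightProjector Summit.Ventures.HodgeRepro2.T5IsotypicCopies
  Summit.Ventures.HodgeRepro2.T5CircleWeights
  Summit.Ventures.HodgeRepro2.T5CircleWeightSpaces

section General

variable {G : Type*} [Group G] [TopologicalSpace G] [IsTopologicalGroup G] [MeasurableSpace G]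
  [BorelSpace G] [CompactSpace G]
variable {V : Type*} [NormedAddCommGroup V] [InnerProductSpace ℂ V] [FiniteDimensional ℂ V]
variable {W₀ W₁ : Type*} [NormedAddCommGroup W₀] [InnerProductSpace ℂ W₀] [FiniteDimensional ℂ W₀]
  [NormedAddCommGroup W₁] [InnerProductSpace ℂ W₁] [FiniteDimensional ℂ W₁]
variable (μ : Measure G) [IsProbabilityMeasure μ] [μ.IsMulLeftInvariant] [μ.IsMulRightInvariant]
  [μ.IsOpenPosMeasure]
variable (π : G →* V →L[ℂ] V) (σ : G →* W₀ →L[ℂ] W₀) (τ : G →* W₁ →L[ℂ] W₁)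

omit [FiniteDimensional ℂ W₁] in
/-- The `K`-type projector of `σ` vanishes on the `τ`-isotypic component when `τ ≄ σ`. -/
theorem charProj_apply_eq_zero_of_mem_isotypic (hπ : Continuous π) (hσ : Continuous σ)
    (hσi : IsIrreducible σ) [Nontrivial W₀] (hne : IsEmpty ((toRep σ).Equiv (toRep τ))) {v : V}
    (hv : v ∈ isotypic π τ) : charProj μ π σ hπ hσ v = 0 := by
  induction hv using Submodule.iSup_induction' with
  | mem W x hx =>
    obtain ⟨hirr, ⟨e⟩⟩ := W.2
    refine charProj_apply_eq_zero_of_isEmpty_equiv μ π σ hπ hσ hσi hirr ⟨fun f => ?_⟩ hx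
    exact hne.false (f.trans e.symm)
  | zero => exact map_zero _
  | add x y _ _ hx hy => rw [map_add, hx, hy, add_zero]

/-- The weight projector of `χ` vanishes on the weight space of `χ' ≠ χ`. -/
theorem weightProj_apply_eq_zero_of_mem_weightSpace (hπ : Continuous π) {χ χ' : G →* ℂˣ}
    (hχ : Continuous fun k => (χ k : ℂ)) (h : χ ≠ χ') {v : V} (hv : v ∈ weightSpace π χ') :
    weightProj μ π χ hπ hχ v = 0 := by
  rw [weightProj]
  rw [← isotypic_charRep_eq_weightSpace] at hv
  exact charProj_apply_eq_zero_of_mem_isotypic μ π (charRep χ) (charRep χ') hπ _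
    (isIrreducible_charRep χ) (T5WeightDecomposition.isEmpty_equiv_charRep_of_ne h) hv

end General

section Circle

variable [MeasurableSpace Circle] [BorelSpace Circle]
variable {V : Type*} [NormedAddCommGroup V] [InnerProductSpace ℂ V] [FiniteDimensional ℂ V]
variable (μ : Measure Circle) [IsProbabilityMeasure μ] [μ.IsMulLeftInvariant]
  [μ.IsMulRightInvariant] [μ.IsOpenPosMeasure]
variable (π : Circle →* V →L[ℂ] V)

omit [MeasurableSpace Circle] [BorelSpace Circle] in
/-- The character `z ↦ zⁿ` of the circle is continuous. -/
lemma continuous_coe_zpowChar (n : ℤ) : Continuous fun z : Circle => ((zpowChar n z : ℂˣ) : ℂ) := by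
  simp only [coe_zpowChar_apply]
  exact (continuous_subtype_val.comp continuous_id).zpow₀ n fun z => Or.inl (Circle.coe_ne_zero z)

omit [FiniteDimensional ℂ V] [μ.IsMulLeftInvariant] [μ.IsMulRightInvariant] [μ.IsOpenPosMeasure] in
/-- The weight projector of `z ↦ zⁿ`: `v ↦ ∫ conj (zⁿ) • π z v ∂μ`. -/
theorem weightProj_zpowChar_apply (hπ : Continuous π) (n : ℤ) (v : V) :
    weightProj μ π (zpowChar n) hπ (continuous_coe_zpowChar n) v =
      ∫ z, (starRingEnd ℂ) ((z : ℂ) ^ n) • π z v ∂μ := by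
  rw [weightProj_apply]
  simp only [coe_zpowChar_apply]

/-- **The Fourier expansion into `K`-types**: `v = Σ_{n ∈ weights π} Pₙ v`. -/
theorem sum_weightProj_zpowChar_eq_self (hπ : Continuous π) (v : V) :
    ∑ n ∈ weights π, weightProj μ π (zpowChar n) hπ (continuous_coe_zpowChar n) v = v := by
  have hv : v ∈ ⨆ n : ℤ, weightSpace π (zpowChar n) := by
    rw [iSup_weightSpace_zpowChar_eq_top π hπ]; exact Submodule.mem_top
  induction hv using Submodule.iSup_induction' with
  | mem n x hx =>
    by_cases hx0 : x = 0
    · subst hx0; simp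
    · have hn : n ∈ weights π := by
        rw [mem_weights]
        exact fun hbot => hx0 (by simpa [hbot] using hx)
      rw [Finset.sum_eq_single n]
      · exact (weightProj_apply_eq_self_iff μ π (zpowChar n) hπ _ x).mpr hx
      · intro m _ hmn
        exact weightProj_apply_eq_zero_of_mem_weightSpace μ π hπ _
          (fun h => hmn (zpowChar_injective h)) hx
      · intro hn'; exact absurd hn hn'
  | zero => simp
  | add x y _ _ hx hy => simp only [map_add, Finset.sum_add_distrib, hx, hy]

end Circle

end Summit.Ventures.HodgeRepro2.T5WeightProjectorSum
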